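import Summits.ABC.IUTFork.Joshi.ATS4LogDiffConductorWildGeneral
import Mathlib.NumberTheory.NumberField.Cyclotomic.Ideal
import HarnessLib

/-!
# Joshi, *Arithmetic Teichmüller Spaces IV* (arXiv:2403.10430v2) Thm. 4.6.1 (5): a kernel WITNESS that the typed `WildBound`
# (hypothesis «wild primes lie over S_wild» only) is not a theorem — `ℚ(ζ₃)/ℚ`, `S = S_wild = ∅`

Proof-only sequel of `Joshi/ATS4LogDiffConductorWildGeneral.lean` (abc-iut cell, branch E, rung LADDER-ABC:A2.E; seat abc-iut-E-t27,
slot T-27). **No side is taken** on [IUTchIII] Cor. 3.12, on Joshi's claims, or on Mochizuki's reports on them; unrefereed preprint;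
the mathematics here is classical (ramification in `ℚ(ζ₃)`, Mathlib's `IsCyclotomicExtension.Rat.ramificationIdx_eq_of_prime` /
`…_of_not_dvd`). Locators «p.N l.M» refer to the render `HOME/lit/renders/Joshi-arxiv-2403.10430/` (v2).

`not_wildBound_of_isTame_of_ramified_outside` (p437212) located the failure of the typed `WildBound L M S ∅` at every `M/L` tamely
ramified everywhere and ramified somewhere outside `V^{odd,ss}_M`, leaving the inhabitation of that hypothesis to prose («e.g.
`ℚ(√5)/ℚ`»). Here the hypothesis is INHABITED in the kernel by `M = ℚ(ζ₃) = CyclotomicField 3 ℚ` over `L = ℚ` with `S = ∅`: the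
prime over `3` has `e = 2` (`3 ∤ 2`: tame, ramified), every other prime has `e = 1`. Hence:

* `isTame_rat_cyclotomicField_three`, `exists_relRamIdx_eq_two_cyclotomicField_three`;
* **`not_wildBound_rat_cyclotomicField_three : ¬ WildBound ℚ (CyclotomicField 3 ℚ) ∅ ∅`** and
  **`not_forall_wildBound`**: the typed [J-IV] Thm. 4.6.1 (5) — «(log d_M + log f_M) − (log d_L + log f_L) ≤ #S^ℚ_wild·log[M:L]»
  (p.46 l.42–46) under the sole hypothesis that the wild primes lie over `S_wild` — is FALSE as a universally quantified statement;
  with the presupposition «`M/L` unramified outside `V^{odd,ss}_M`» (flag F-b) it is the theorem `wildBound_of_unramifiedOutside`.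
  Located, not adjudicated: the printed uses of (5) (Lem. 6.4.1/6.4.2) are covered by the Galois/Step (ii) route
  (`ATS4MainBoundsGenuine.lean`, `ATS4MainBoundsWildGenuine.lean`).

Glue of independent use: `relRamIdx_rat_eq` (`e_{w|v} = e(w|p)` over `L = ℚ`; the step `e(v|ℤ) = 1` on `𝓞 ℚ` is a private copy of
the tree's `Literature.NumberTheory.EllipticCurves.Fisher2016.ramificationIdx_int_rat_eq_one`). Theorems only; standard axioms; no `sorry`, instance, notation or new `Prop` fact. [claim: Joshi2024ATS4, status: disputed]
(provenance of the typed item; nothing endorsed).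
-/

noncomputable section

namespace Summit.ABC.IUTFork.Joshi.ATS4

namespace LogDiffCond

open NumberField IsDedekindDomain Ideal Module

/-! ### Over `L = ℚ`: `e_{w|v}` is the absolute ramification index -/

/-- `e(v | ℤ) = 1` for every prime `v` of `𝓞 ℚ` (`e(v|ℤ) ≤ [ℚ:ℚ] = 1`, Mathlib `Ideal.ramificationIdx_le_finrank`). Private copy of the
tree's `Literature.NumberTheory.EllipticCurves.Fisher2016.ramificationIdx_int_rat_eq_one` (not imported: its module pulls the whole
congruence-visibility chain into this Joshi file). [folklore] -/
private theorem ramificationIdx_int_eq_one_rat (v : HeightOneSpectrum (𝓞 ℚ)) : v.asIdeal.ramificationIdx ℤ = 1 := by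
  haveI : v.asIdeal.IsMaximal := v.isMaximal
  have hne : v.asIdeal.under ℤ ≠ ⊥ := Ideal.under_ne_bot ℤ v.ne_bot
  haveI : (v.asIdeal.under ℤ).IsMaximal := Ideal.IsMaximal.under ℤ v.asIdeal
  haveI : v.asIdeal.LiesOver (v.asIdeal.under ℤ) := ⟨rfl⟩
  have hle : v.asIdeal.ramificationIdx ℤ ≤ Module.finrank ℚ ℚ := by
    rw [← Ideal.ramificationIdx'_eq_ramificationIdx (v.asIdeal.under ℤ) v.asIdeal hne]
    exact Ideal.ramificationIdx_le_finrank (R := ℤ) (S := 𝓞 ℚ) ℚ ℚ v.asIdeal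
  rw [Module.finrank_self] at hle
  have hpos : 0 < v.asIdeal.ramificationIdx ℤ := Ideal.ramificationIdx_pos v.asIdeal ℤ
  omega

/-- Over `L = ℚ` the typed relative index `e_{w|v}` is the absolute ramification index `e(w|p)` (tower law
`e(w|ℤ) = e(v|ℤ)·e(w|𝓞_ℚ)` and `e(v|ℤ) = 1`). [folklore] -/
theorem relRamIdx_rat_eq (K : Type*) [Field K] [NumberField K] (w : HeightOneSpectrum (𝓞 K)) :
    relRamIdx ℚ K w = w.asIdeal.ramificationIdx ℤ := by
  haveI := w.isMaximal
  haveI : w.asIdeal.LiesOver (w.asIdeal.under (𝓞 ℚ)) := ⟨rfl⟩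
  have htower := Ideal.ramificationIdx_tower (R := ℤ) (w.asIdeal.under (𝓞 ℚ)) w.asIdeal
  have h1 : (w.asIdeal.under (𝓞 ℚ)).ramificationIdx ℤ = 1 := by
    have := ramificationIdx_int_eq_one_rat (w.under (𝓞 ℚ))
    rwa [HeightOneSpectrum.under_asIdeal] at this
  rw [relRamIdx_eq, htower, h1, one_mul]

/-! ### `ℚ(ζ₃)/ℚ`: tame everywhere, ramified at `3` -/

/-- **`ℚ(ζ₃)/ℚ` is tamely ramified at every prime**: over `3` the ramification index is `3 − 1 = 2` (Mathlib
`IsCyclotomicExtension.Rat.ramificationIdx_eq_of_prime`), `3 ∤ 2`; over `p ≠ 3` it is `1` (`…ramificationIdx_eq_of_not_dvd`).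
[folklore] -/
theorem isTame_rat_cyclotomicField_three : IsTame ℚ (CyclotomicField 3 ℚ) := by
  intro w
  haveI := w.isMaximal
  haveI : IsCyclotomicExtension {3} ℚ (CyclotomicField 3 ℚ) := CyclotomicField.isCyclotomicExtension 3 ℚ
  set p := Literature.IUT.LogVolume.residueChar (CyclotomicField 3 ℚ) w with hp
  have hpp : p.Prime := Literature.IUT.LogVolume.residueChar_prime (CyclotomicField 3 ℚ) w
  haveI : Fact p.Prime := ⟨hpp⟩
  haveI hover : w.asIdeal.LiesOver (Ideal.span {(p : ℤ)}) :=
    Literature.IUT.LogVolume.liesOver_residueChar (CyclotomicField 3 ℚ) w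
  rw [IsTameAt, residueChar_eq, relRamIdx_rat_eq, ← hp]
  by_cases h3 : p = 3
  · clear_value p
    subst h3
    rw [IsCyclotomicExtension.Rat.ramificationIdx_eq_of_prime 3 (CyclotomicField 3 ℚ) w.asIdeal]
    decide
  · have hnd : ¬ p ∣ 3 := fun hd => h3 ((Nat.prime_dvd_prime_iff_eq hpp Nat.prime_three).mp hd)
    rw [IsCyclotomicExtension.Rat.ramificationIdx_eq_of_not_dvd (m := 3) p (CyclotomicField 3 ℚ) w.asIdeal hnd]
    exact hpp.not_dvd_one

/-- **`ℚ(ζ₃)/ℚ` is ramified**: some prime `w₀` (the one over `3`) has `e_{w₀|3} = 2`. [folklore] -/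
theorem exists_relRamIdx_eq_two_cyclotomicField_three :
    ∃ w₀ : HeightOneSpectrum (𝓞 (CyclotomicField 3 ℚ)), relRamIdx ℚ (CyclotomicField 3 ℚ) w₀ = 2 := by
  haveI : IsCyclotomicExtension {3} ℚ (CyclotomicField 3 ℚ) := CyclotomicField.isCyclotomicExtension 3 ℚ
  haveI : (Ideal.span {((3 : ℕ) : ℤ)}).IsMaximal := Int.ideal_span_isMaximal_of_prime 3
  obtain ⟨W, hWmax, hW3⟩ :=
    Ideal.exists_maximal_ideal_liesOver_of_isIntegral (S := 𝓞 (CyclotomicField 3 ℚ)) (Ideal.span {((3 : ℕ) : ℤ)})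
  have hW : W ≠ ⊥ := Ideal.IsMaximal.ne_bot_of_isIntegral_int W
  haveI := hW3
  refine ⟨⟨W, hWmax.isPrime, hW⟩, ?_⟩
  rw [relRamIdx_rat_eq]
  show W.ramificationIdx ℤ = 2
  rw [IsCyclotomicExtension.Rat.ramificationIdx_eq_of_prime 3 (CyclotomicField 3 ℚ) W]

/-! ### The typed (5) is not a theorem -/

/-- **`¬ WildBound ℚ ℚ(ζ₃) ∅ ∅`** — the typed [J-IV] Thm. 4.6.1 (5) fails at `L = ℚ`, `M = ℚ(ζ₃)`, `V^{odd,ss}_L = S_wild = ∅`: there is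
no wild prime (so the typed hypothesis holds vacuously-in-content), `#S^ℚ_wild = 0`, yet `Δ = ½·log 3 > 0` because `3` is (tamely)
ramified outside `V^{odd,ss}_M = ∅` (`not_wildBound_of_isTame_of_ramified_outside`). Located correction (flag F-b) in closed kernel form;
not an adjudication of any printed use of (5). [cite: MochizukiGenEll2010, Prop 1.7 (i) p.9] -/
theorem not_wildBound_rat_cyclotomicField_three : ¬ WildBound ℚ (CyclotomicField 3 ℚ) ∅ ∅ := by
  obtain ⟨w₀, hw₀⟩ := exists_relRamIdx_eq_two_cyclotomicField_three
  refine not_wildBound_of_isTame_of_ramified_outside ℚ (CyclotomicField 3 ℚ) ∅ isTame_rat_cyclotomicField_three w₀ ?_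
    (by rw [hw₀]; decide)
  rw [mem_ssAbove]
  exact Finset.notMem_empty _

/-- **The typed (5) is FALSE as a universally quantified statement** over extensions of number fields `M/L` and finite sets `S`,
`S_wild`: `¬ ∀ L M S S_wild, WildBound L M S S_wild` (witness `ℚ(ζ₃)/ℚ`, `∅`, `∅`). With the located presupposition «`M/L` unramified
outside `V^{odd,ss}_M`» it holds for every `M/L` (`wildBound_of_unramifiedOutside`). [cite: MochizukiGenEll2010, Prop 1.7 (i) p.9] -/
theorem not_forall_wildBound :
    ¬ ∀ (L M : Type) [Field L] [NumberField L] [Field M] [NumberField M] [Algebra L M]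
        (S Swild : Finset (HeightOneSpectrum (𝓞 L))), WildBound L M S Swild :=
  fun h => not_wildBound_rat_cyclotomicField_three (h ℚ (CyclotomicField 3 ℚ) ∅ ∅)

end LogDiffCond

end Summit.ABC.IUTFork.Joshi.ATS4

end
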